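import Literature.Analysis.FluidPDE.SelfSimilarEulerOutgoingFlatVorticity
import Literature.Analysis.FluidPDE.SelfSimilarEulerOutgoingExclusionTools
import HarnessLib

/-!
# The self-similar Bernoulli function: gradient, stagnation points as critical points, and the
# second-order test at a local maximum ("the Bernoulli-top stagnation point is never vortical")

Analysis/FluidPDE proofs file (theorems only), fourth part of the Eulerian treatment of
Constantin–Ignatova–Vicol 2026 (arXiv:2602.17570) §3.4.3–§3.5 on putative `C²` self-similar
Euler profiles `(U, P)` (CIV (3.3), exponent `γ`, centre `c`; `V = γ(y − c) + U`,
`ℋ = ½|V|² + P + ½γ(γ−1)|y−c|²` the self-similar Bernoulli function (3.30)).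

* `IsSelfSimilarEulerProfile.fderiv_selfSimilarBernoulli_apply` — the full gradient of `ℋ`
  (CIV (3.29): `∇ℋ = −(1−2γ)V − Ω × V`), in the adjoint-free form
  `Dℋ(y)[w] = (2γ−1)⟪V, w⟫ + ⟪V, DU w⟫ − ⟪DU V, w⟫`; along `w = V` this is the tree's (3.31).
  In particular the critical points of `ℋ` are exactly the stagnation points of `V` when
  `γ ≠ ½` (`fderiv_selfSimilarBernoulli_eq_zero_iff`).
* `IsSelfSimilarEulerProfile.rayHessian_nonpos_of_isLocalMax` — **second-order test**: if a
  stagnation point `z` is a local maximum of `ℋ`, then for every direction `v`, with `B = DU(z)`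
  and `A v = γ v + B v = DV(z) v`,
  `(2γ−1)⟪A v, v⟫ + ⟪A v, B v⟫ − ⟪B(A v), v⟫ ≤ 0` (the derivative of `s ↦ ℋ(z + s v)` is
  `s·(this) + o(s)`; a positive value would make `ℋ` increase along the ray).

Sequel `SelfSimilarEulerBernoulliLocalMax.lean`: a VORTICAL stagnation point is never a local
maximum of `ℋ`, and a stagnation point that is a local maximum of `ℋ` has `DV(z) ≥ 0` (stretching
rates `≤ 2γ|w|² < |w|²` in the window) — the linear algebra of the eigenvalue-one direction.

## References

* P. Constantin, M. Ignatova, V. Vicol, arXiv:2602.17570 (2026), §3.4.3 (3.29)–(3.33), §3.5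
  Thm. 3.8 (`𝕊Ω = Ω` at a vortical node). [ConstantinIgnatovaVicol2026Putative]

## Mathlib / tree search

Reused: `fderiv_selfSimilarBernoulli_transport` (pattern and (3.31)), `contDiff_selfSimilarBernoulli`.
Mathlib: `strictMonoOn_of_deriv_pos`, `HasDerivAt.tendsto_slope_zero_right`,
`isBoundedBilinearMap_apply`, `Metric.eventually_nhds_iff_ball`.
-/

noncomputable section

open Set Filter Topology InnerProductSpace Metric
open scoped RealInnerProductSpace

namespace Literature.Analysis.FluidPDE

namespace IsSelfSimilarEulerProfile

section General

variable {E : Type*} [NormedAddCommGroup E] [InnerProductSpace ℝ E] [FiniteDimensional ℝ E]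
variable {γ : ℝ} {c : E} {U : E → E} {P : E → ℝ}

/-- **The gradient of the self-similar Bernoulli function** (CIV (3.29) `(1−2γ)V + Ω × V + ∇ℋ = 0`,
in adjoint-free form): for a profile `(U, P)` and all `y, w`,
`Dℋ(y)[w] = (2γ − 1)⟪V(y), w⟫ + ⟪V(y), DU(y) w⟫ − ⟪DU(y) V(y), w⟫`, `V = γ(y−c) + U`. Proof:
`Dℋ[w] = ⟪V, (γ + DU) w⟫ + DP[w] + γ(γ−1)⟪y−c, w⟫` and, by (3.3) dotted with `w`,
`DP[w] = −(1−γ)⟪U, w⟫ − ⟪DU V, w⟫`. [cite: ConstantinIgnatovaVicol2026Putative, §3.4.3 eq. (3.29)] -/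
theorem fderiv_selfSimilarBernoulli_apply (h : IsSelfSimilarEulerProfile γ c U P) (y w : E) :
    fderiv ℝ (selfSimilarBernoulli γ c U P) y w =
      (2 * γ - 1) * ⟪selfSimilarTransport γ c U y, w⟫ +
        (⟪selfSimilarTransport γ c U y, fderiv ℝ U y w⟫ -
          ⟪fderiv ℝ U y (selfSimilarTransport γ c U y), w⟫) := by
  simp only [selfSimilarTransport_apply]
  have hU : HasFDerivAt U (fderiv ℝ U y) y := (h.differentiable_velocity y).hasFDerivAt
  have hV : HasFDerivAt (fun z => γ • (z - c) + U z)
      (γ • ContinuousLinearMap.id ℝ E + fderiv ℝ U y) y :=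
    (((hasFDerivAt_id y).sub_const c).fun_const_smul γ).fun_add hU
  have hP : HasFDerivAt P (fderiv ℝ P y) y := (h.differentiable_pressure y).hasFDerivAt
  have hsq := ((hasFDerivAt_id y).sub_const c).norm_sq
  have e := ((hV.norm_sq.const_mul (1 / 2 : ℝ)).fun_add hP).fun_add
    (hsq.const_mul (γ * (γ - 1) / 2))
  have hH : HasFDerivAt (selfSimilarBernoulli γ c U P) _ y :=
    e.congr_of_eventuallyEq (Filter.Eventually.of_forall fun z => rfl)
  rw [hH.fderiv]
  -- the profile equation (3.3) dotted with `w`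
  have key : ⟪fderiv ℝ U y (γ • (y - c) + U y), w⟫ =
      -((1 - γ) * ⟪U y, w⟫) - fderiv ℝ P y w := by
    have e2 := congrArg (fun z => ⟪z, w⟫) (h.profile_eq y)
    simp only [inner_add_left, inner_smul_left, inner_zero_left, conj_trivial] at e2
    rw [inner_gradient_left] at e2
    linarith
  have h5 : ⟪U y, w⟫ = ⟪γ • (y - c) + U y, w⟫ - γ * ⟪y - c, w⟫ := by
    rw [inner_add_left, inner_smul_left, conj_trivial]; ring
  simp only [_root_.add_apply, _root_.smul_apply, two_nsmul, ContinuousLinearMap.comp_apply,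
    ContinuousLinearMap.id_apply, innerSL_apply_apply, smul_eq_mul, id_eq]
  rw [inner_add_right, inner_smul_right, key, h5]
  ring
end General

section Three

variable {γ : ℝ} {c : EuclideanSpace ℝ (Fin 3)}
  {U : EuclideanSpace ℝ (Fin 3) → EuclideanSpace ℝ (Fin 3)} {P : EuclideanSpace ℝ (Fin 3) → ℝ}

/-- **Stagnation points are the critical points of `ℋ`** (`γ ≠ ½`): `Dℋ(y) = 0 ↔ V(y) = 0`
(CIV (3.33): "`V·∇ℋ = (2γ−1)|V|²` vanishes only on `𝒩_V`"; conversely at a stagnation point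
every term of the gradient formula carries a factor `V(y)`). [cite: ConstantinIgnatovaVicol2026Putative, §3.4.3 eq. (3.31)–(3.33)] -/
theorem fderiv_selfSimilarBernoulli_eq_zero_iff (h : IsSelfSimilarEulerProfile γ c U P)
    (hγ : γ ≠ 1 / 2) (y : EuclideanSpace ℝ (Fin 3)) :
    fderiv ℝ (selfSimilarBernoulli γ c U P) y = 0 ↔ y ∈ selfSimilarNodalSet γ c U := by
  constructor
  · intro h0
    have e := h.fderiv_selfSimilarBernoulli_transport y
    have e0 : fderiv ℝ (selfSimilarBernoulli γ c U P) y (selfSimilarTransport γ c U y) = 0 := by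
      rw [h0]; rfl
    rw [e0] at e
    have h2 : 2 * γ - 1 ≠ 0 := by intro h1; apply hγ; linarith
    have : ‖selfSimilarTransport γ c U y‖ ^ 2 = 0 := by
      rcases mul_eq_zero.1 e.symm with h1 | h1
      · exact absurd h1 h2
      · exact h1
    exact norm_eq_zero.1 (pow_eq_zero_iff (n := 2) (by norm_num) |>.1 this)
  · intro hy
    have hV0 : selfSimilarTransport γ c U y = 0 := hy
    ext w
    rw [h.fderiv_selfSimilarBernoulli_apply, hV0]
    simp

/-- **Second-order test at a local maximum of `ℋ` along rays.** Let `z` be a stagnation point that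
is a local maximum of the Bernoulli function `ℋ`. Then for every direction `v`, with `B = DU(z)`,
`A v = γ v + B v`: `(2γ−1)⟪A v, v⟫ + ⟪A v, B v⟫ − ⟪B(A v), v⟫ ≤ 0`. Proof: with
`g(s) = ℋ(z + s v)`, the gradient formula gives `g'(s) = (2γ−1)⟪V, v⟫ + ⟪V, B(·)v⟫ − ⟪B(·)V, v⟫`
at `z + s v`, and `V(z + s v)/s → A v`, so `g'(s)/s →` the form; were it positive, `g` would be
strictly increasing on some `[0, s₀]`, contradicting the local maximum. [cite: ConstantinIgnatovaVicol2026Putative, §3.4.3 eq. (3.29)–(3.33) (second variation; not in print)] -/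
theorem rayHessian_nonpos_of_isLocalMax (h : IsSelfSimilarEulerProfile γ c U P)
    {z : EuclideanSpace ℝ (Fin 3)} (hz : z ∈ selfSimilarNodalSet γ c U)
    (hmax : IsLocalMax (selfSimilarBernoulli γ c U P) z) (v : EuclideanSpace ℝ (Fin 3)) :
    (2 * γ - 1) * ⟪γ • v + fderiv ℝ U z v, v⟫ +
      (⟪γ • v + fderiv ℝ U z v, fderiv ℝ U z v⟫ - ⟪fderiv ℝ U z (γ • v + fderiv ℝ U z v), v⟫) ≤ 0 := by
  -- notation
  set Hb : EuclideanSpace ℝ (Fin 3) → ℝ := selfSimilarBernoulli γ c U P with hHbdef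
  set V : EuclideanSpace ℝ (Fin 3) → EuclideanSpace ℝ (Fin 3) := selfSimilarTransport γ c U
    with hVdef
  set B : EuclideanSpace ℝ (Fin 3) → (EuclideanSpace ℝ (Fin 3) →L[ℝ] EuclideanSpace ℝ (Fin 3)) :=
    fun y => fderiv ℝ U y with hBdef
  set L : ℝ := (2 * γ - 1) * ⟪γ • v + B z v, v⟫ +
      (⟪γ • v + B z v, B z v⟫ - ⟪B z (γ • v + B z v), v⟫) with hLdef
  show L ≤ 0
  have hU2 : ContDiff ℝ 2 U := h.contDiff_velocity
  have hUd : Differentiable ℝ U := hU2.differentiable (by norm_num)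
  have hBc : Continuous B := hU2.continuous_fderiv (by norm_num)
  have hH1 : ContDiff ℝ 1 Hb := h.contDiff_selfSimilarBernoulli
  have hHd : Differentiable ℝ Hb := hH1.differentiable one_ne_zero
  have hV0 : V z = 0 := hz
  -- the ray `s ↦ z + s • v` and `g = ℋ` along it
  set ℓ : ℝ → EuclideanSpace ℝ (Fin 3) := fun s => z + s • v with hℓdef
  have hℓ : ∀ s, HasDerivAt ℓ v s := fun s => by
    have := ((hasDerivAt_id s).smul_const v).const_add z
    simpa [hℓdef] using this
  have hℓc : Continuous ℓ := (continuous_const.add (continuous_id.smul continuous_const))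
  have hℓ0 : ℓ 0 = z := by simp [hℓdef]
  set g : ℝ → ℝ := fun s => Hb (ℓ s) with hgdef
  have hg : ∀ s, HasDerivAt g (fderiv ℝ Hb (ℓ s) v) s := fun s =>
    (hHd (ℓ s)).hasFDerivAt.comp_hasDerivAt s (hℓ s)
  have hg' : ∀ s, deriv g s = fderiv ℝ Hb (ℓ s) v := fun s => (hg s).deriv
  have hgc : Continuous g := hH1.continuous.comp hℓc
  -- the derivative along the ray, from the gradient formula
  have hderiv : ∀ s, deriv g s =
      (2 * γ - 1) * ⟪V (ℓ s), v⟫ + (⟪V (ℓ s), B (ℓ s) v⟫ - ⟪B (ℓ s) (V (ℓ s)), v⟫) := by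
    intro s
    rw [hg' s, hHbdef, h.fderiv_selfSimilarBernoulli_apply]
  -- the slope of `V` along the ray tends to `A v = γ v + B z v`
  have hVslope : Tendsto (fun s : ℝ => s⁻¹ • V (ℓ s)) (𝓝[>] 0) (𝓝 (γ • v + B z v)) := by
    have hUz : HasFDerivAt U (B z) z := (hUd z).hasFDerivAt
    have hVz : HasFDerivAt V (γ • ContinuousLinearMap.id ℝ _ + B z) z := by
      have := (((hasFDerivAt_id z).sub_const c).fun_const_smul γ).fun_add hUz
      exact this
    have hcomp : HasDerivAt (fun s => V (ℓ s))
        ((γ • ContinuousLinearMap.id ℝ (EuclideanSpace ℝ (Fin 3)) + B z) v) 0 :=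
      hVz.comp_hasDerivAt_of_eq 0 (hℓ 0) hℓ0.symm
    have hT := hcomp.tendsto_slope_zero_right
    have e1 : ∀ t : ℝ, t⁻¹ • (V (ℓ (0 + t)) - V (ℓ 0)) = t⁻¹ • V (ℓ t) := by
      intro t; rw [zero_add, hℓ0, hV0, sub_zero]
    simp_rw [e1] at hT
    have e2 : (γ • ContinuousLinearMap.id ℝ (EuclideanSpace ℝ (Fin 3)) + B z) v = γ • v + B z v := by
      simp
    rw [e2] at hT
    exact hT
  have hBlim : Tendsto (fun s : ℝ => B (ℓ s)) (𝓝[>] 0) (𝓝 (B z)) := by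
    have : Tendsto (fun s : ℝ => B (ℓ s)) (𝓝 0) (𝓝 (B (ℓ 0))) :=
      (hBc.comp hℓc).continuousAt
    rw [hℓ0] at this
    exact this.mono_left nhdsWithin_le_nhds
  -- hence `deriv g s / s → L`
  have hLlim : Tendsto (fun s : ℝ => s⁻¹ * deriv g s) (𝓝[>] 0) (𝓝 L) := by
    have e : ∀ s : ℝ, s⁻¹ * deriv g s = (2 * γ - 1) * ⟪s⁻¹ • V (ℓ s), v⟫ +
        (⟪s⁻¹ • V (ℓ s), B (ℓ s) v⟫ - ⟪B (ℓ s) (s⁻¹ • V (ℓ s)), v⟫) := by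
      intro s
      rw [hderiv s, map_smul, inner_smul_left, inner_smul_left, inner_smul_left]
      simp only [conj_trivial]
      ring
    simp_rw [e]
    have hev : Tendsto (fun s : ℝ => B (ℓ s) v) (𝓝[>] 0) (𝓝 (B z v)) :=
      ((isBoundedBilinearMap_apply (𝕜 := ℝ) (E := EuclideanSpace ℝ (Fin 3))
        (F := EuclideanSpace ℝ (Fin 3))).continuous.tendsto (B z, v)).comp
        (hBlim.prodMk_nhds tendsto_const_nhds)
    have hev2 : Tendsto (fun s : ℝ => B (ℓ s) (s⁻¹ • V (ℓ s))) (𝓝[>] 0)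
        (𝓝 (B z (γ • v + B z v))) :=
      ((isBoundedBilinearMap_apply (𝕜 := ℝ) (E := EuclideanSpace ℝ (Fin 3))
        (F := EuclideanSpace ℝ (Fin 3))).continuous.tendsto (B z, γ • v + B z v)).comp
        (hBlim.prodMk_nhds hVslope)
    exact ((hVslope.inner tendsto_const_nhds).const_mul _).add
      ((hVslope.inner hev).sub (hev2.inner tendsto_const_nhds))
  -- suppose `L > 0`
  by_contra hcon
  have hLpos : 0 < L := lt_of_not_ge hcon
  -- then `deriv g > 0` on some `(0, δ₁)`
  have hev1 : ∀ᶠ s in 𝓝[>] (0 : ℝ), L / 2 < s⁻¹ * deriv g s :=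
    hLlim (Ioi_mem_nhds (by linarith))
  rw [eventually_nhdsWithin_iff, Metric.eventually_nhds_iff_ball] at hev1
  obtain ⟨δ₁, hδ₁, h1⟩ := hev1
  -- and `g ≤ g 0` on some `(-δ₂, δ₂)` (local maximum)
  have hmax' : IsLocalMax g 0 := by
    have : IsLocalMax Hb (ℓ 0) := by rw [hℓ0]; exact hmax
    exact this.comp_continuous hℓc.continuousAt
  have hev2 : ∀ᶠ s in 𝓝 (0 : ℝ), g s ≤ g 0 := hmax'
  rw [Metric.eventually_nhds_iff_ball] at hev2
  obtain ⟨δ₂, hδ₂, h2⟩ := hev2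
  -- take `s₀ = min δ₁ δ₂ / 2`
  set s₀ : ℝ := min δ₁ δ₂ / 2 with hs₀
  have hs₀pos : 0 < s₀ := by rw [hs₀]; positivity
  have hs₀1 : s₀ < δ₁ := by
    rw [hs₀]; linarith [min_le_left δ₁ δ₂]
  have hs₀2 : s₀ < δ₂ := by
    rw [hs₀]; linarith [min_le_right δ₁ δ₂]
  have hmono : StrictMonoOn g (Icc 0 s₀) := by
    refine strictMonoOn_of_deriv_pos (convex_Icc 0 s₀) hgc.continuousOn fun x hx => ?_
    rw [interior_Icc] at hx
    have hxball : x ∈ ball (0 : ℝ) δ₁ := by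
      rw [mem_ball, dist_zero_right, Real.norm_eq_abs, abs_of_pos hx.1]; linarith [hx.2]
    have hq := h1 x hxball hx.1
    have hx0 : 0 < x := hx.1
    by_contra hle
    have : x⁻¹ * deriv g x ≤ 0 :=
      mul_nonpos_of_nonneg_of_nonpos (inv_nonneg.2 hx0.le) (not_lt.1 hle)
    linarith
  have hlt : g 0 < g s₀ :=
    hmono (left_mem_Icc.2 hs₀pos.le) (right_mem_Icc.2 hs₀pos.le) hs₀pos
  have hle : g s₀ ≤ g 0 := h2 s₀ (by
    rw [mem_ball, dist_zero_right, Real.norm_eq_abs, abs_of_pos hs₀pos]; exact hs₀2)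
  linarith

end Three

end IsSelfSimilarEulerProfile
end Literature.Analysis.FluidPDE
end
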